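import Summits.Schanuel.Schanuel.Theorems.RootDecomp1KCollarWall02

/-!
# RootDecomp1KCollarWall — lens 1, generation 49, node 8 «THE COLLAR WALL: item 33364 decided hyp-free at the exhibited fixed-finite-order tuple z♮₃ = (1, ℓ₂, ρ♮₂) and its π-twin, via a class-level wall engine for DyadicCollarLiouville against any θ⃗ with MvPolyMeasure» — continuation (RootDecomp1KCollarWall03): §3 (W4) the collar walls for the whole class, hyp-free

(lens-1 g49 HOME kernel K = HOME/decomp-schanuel-lens-1/g49/CollarWall.lean 402bd26b…, 1041 l, imports …RootDecomp1KCollarCell05 + …RootDecomp1KNWMeasureHolds BY NAME; P CollarWallProbe.lean / C CollarWallCtrl.lean; memo NODE-g49.md; CLAIM L2443, EX-ANTE PRICE + CHECKLIST K-g49 L2444, NODE L2450 / REQUEST L2451; critic VERDICT L2454: CLEARED AS PRICED — ONE CELL ×1 «COLLAR WALL», RULE K-R38, PORT GO. Port by census-1 gen 21 as `RootDecomp1KCollarWall01–05` along K's §1–§4 with §4 cut at its §4a/§4b sub-headers by the 400-line file cap: 01 = §1 (W1) `mvMaxval₂`, `clearPoly_ne_zero_of_twoAdic` — T1 in the `clearPoly`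 frame (the cleared θ-polynomial at 2-adically interlaced slots is ≠ 0); 02 = §2 (W2) `collar_balance_false` + (W3) **`algebraicIndependent_collar_of_mvPolyMeasure (hρ : DyadicCollarLiouville ρ) (hθ : MvPolyMeasure θ)`** — the COLLAR WALL ENGINE (resonant-height simultaneous specialisation against a transcendental block of polynomial measure); 03 = §3 (W4) the walls for the WHOLE class, hyp-free: `sb_collarWall3`, `sb_collarWall3_pi`, `finiteOrderLiouvilleSchanuel_collarWall3` (item 33364's binders verbatim + one range line), `finiteOrderLiouvilleSchanuel_collarWall3_pi`, `coordLiouvilleSchanuel_collarWall3`; 04 = §4a the ONE-CUT 2-adic linear-form bound at the member: `cutInt`, `cutInt_ne_zero`, `cut_height_bound`, **`form_lower_bound_N`**; 05 = §4b the tuples `zN3 = (1, ℓ₂, ρ♮₂)` / `zN3pi` with every binder of item 33364 certified hyp-free: `linearIndependent_zN3(pi)`, `linLiouville_zN3(pi)`, `not_hyperLinLiouville_zN3(pi)`, `sb_zN3` / `sb_zN3pi`, `finiteOrderLiouvilleSchanuel_at_zN3(pi)`, `item33364_at_zN3`, `rhoNat_two_position`. PORT EDITS (census convention): `set_option linter.dupNamespace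 false` dropped; per-part private helper copies if any; statements and proofs otherwise verbatim (no renames; K's own private markers kept). `--supports stmt-Schanuel-33364`; no census credit carried; rung 0 — nothing here proves Schanuel; no ∀-item moves; 33364, 33363, 31077 stay OPEN.)
-/

noncomputable section

open Polynomial LiouvilleNumber
open scoped Nat

namespace Summit.Schanuel.Schanuel.Theorems.RootDecomp1KCollarWall

open Summit.Schanuel.Schanuel.Theorems.RootDecomp1KCollarCell
open Summit.Schanuel.Schanuel.Theorems.RootDecomp1KGapCell
open Summit.Schanuel.Schanuel.Theorems.RootDecomp1KTwoBaseCell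
open Summit.Schanuel.Schanuel.Theorems.RootDecomp1KRelLiouvilleCell
open Summit.Schanuel.Schanuel.Theorems.RootDecomp1KNWMeasureHolds (nwMeasure_holds polyMeasure_exp_one_holds)
open Summit.Schanuel.Schanuel.Theorems.RootDecomp1KHyper
open Summit.Schanuel.Schanuel.Theorems.RootDecomp1KHyper.HyperCell

/-! ## §3  (W4) THE COLLAR WALLS `(1, ℓ₂, ρ)` and `(π, πℓ₂, πρ)` for the WHOLE class — HYPOTHESIS-FREE -/
section Walls

open IntermediateField

/-- **THE COLLAR WALL `(1, ℓ₂, ρ)`, `ρ` dyadic-collar-Liouville: `SB 3` — HYPOTHESIS-FREE.**  The engine (W3) with the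
block `θ⃗ = (e)`; the polynomial transcendence measure of `e = exp 1` is the TREE theorem
`RootDecomp1KNWMeasureHolds.polyMeasure_exp_one_holds` (Nesterenko–Waldschmidt 1996 Thm 4 (2), discharged in the tree —
NO `hNW` binder), packaged by tree `mvPolyMeasure_one_of_polyMeasure`; the cell by tree `sb_of_algebraicIndependent`. -/
theorem sb_collarWall3 {ρ : ℝ} (hρ : DyadicCollarLiouville ρ) :
    SB 3 ![(1 : ℂ), ((liouvilleNumber 2 : ℝ) : ℂ), (ρ : ℂ)] := by
  have hai := algebraicIndependent_collar_of_mvPolyMeasure hρ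
    (mvPolyMeasure_one_of_polyMeasure polyMeasure_exp_one_holds)
  refine sb_of_algebraicIndependent hai (by simp) ?_
  intro x
  rcases x with i | j
  · simp only [Sum.elim_inl]
    refine Fin.cases ?_ (fun j => ?_) i
    · simp only [Fin.cons_zero]
      exact subset_adjoin ℚ _ (Or.inl (Or.inl ⟨2, by simp⟩))
    · simp only [Fin.cons_succ]
      exact subset_adjoin ℚ _ (Or.inl (Or.inl ⟨1, by simp⟩))
  · simp only [Sum.elim_inr]
    refine subset_adjoin ℚ _ (Or.inl (Or.inr ⟨0, ?_⟩))
    fin_cases j; simp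

/-- **THE COLLAR WALL, π-twin `(π, πℓ₂, πρ)`: `SB 3` — HYPOTHESIS-FREE** (`θ⃗ = (π)`, tree Hyper03 `polyMeasure_pi`). -/
theorem sb_collarWall3_pi {ρ : ℝ} (hρ : DyadicCollarLiouville ρ) :
    SB 3 ![(Real.pi : ℂ), (Real.pi : ℂ) * ((liouvilleNumber 2 : ℝ) : ℂ), (Real.pi : ℂ) * (ρ : ℂ)] := by
  set z : Fin 3 → ℂ :=
    ![(Real.pi : ℂ), (Real.pi : ℂ) * ((liouvilleNumber 2 : ℝ) : ℂ), (Real.pi : ℂ) * (ρ : ℂ)] with hz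
  have hπ0 : (Real.pi : ℂ) ≠ 0 := by exact_mod_cast Real.pi_ne_zero
  have hzm : ∀ i, z i ∈ adjoin ℚ (SFset z ∪ {Complex.I}) := fun i =>
    subset_adjoin ℚ _ (Or.inl (Or.inl ⟨i, rfl⟩))
  have hai := algebraicIndependent_collar_of_mvPolyMeasure hρ (mvPolyMeasure_one_of_polyMeasure polyMeasure_pi)
  refine sb_of_algebraicIndependent hai (by simp) ?_
  intro x
  rcases x with i | j
  · simp only [Sum.elim_inl]
    refine Fin.cases ?_ (fun j => ?_) i
    · simp only [Fin.cons_zero]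
      have e : (ρ : ℂ) = z 2 / z 0 := by simp [hz, mul_div_cancel_left₀ _ hπ0]
      rw [e]; exact div_mem (hzm 2) (hzm 0)
    · simp only [Fin.cons_succ]
      have e : ((liouvilleNumber 2 : ℝ) : ℂ) = z 1 / z 0 := by simp [hz, mul_div_cancel_left₀ _ hπ0]
      rw [e]; exact div_mem (hzm 1) (hzm 0)
  · simp only [Sum.elim_inr]
    have e : (![(Real.pi : ℂ)] : Fin 1 → ℂ) j = z 0 := by fin_cases j; simp [hz]
    rw [e]; exact hzm 0

/-- **ITEM 33364 ON THE COLLAR WALL `(1, ℓ₂, ρ)` — HYPOTHESIS-FREE for the WHOLE class.**  Binders of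
`Summit.Schanuel.Schanuel.Theses.RootDecomp1K.FiniteOrderLiouvilleSchanuel` VERBATIM, with ONE line inserted after
`LinearIndependent ℚ z` — the cell `Set.range z = Set.range ![1, ℓ₂, ρ]`, `ρ` ranging over the DYADIC-COLLAR-LIOUVILLE reals
(outer parameter `hρ : DyadicCollarLiouville ρ` — ORDER + 2-ADIC LOCATION data only).  The two Diophantine binders are not
used by the proof (the conclusion holds outright on the cell); BOTH are CERTIFIED at the member `z♮₃` (§4). -/
theorem finiteOrderLiouvilleSchanuel_collarWall3 {ρ : ℝ} (hρ : DyadicCollarLiouville ρ) :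
    ∀ (n : ℕ) (z : Fin n → ℂ), LinearIndependent ℚ z →
      Set.range z = Set.range ![(1 : ℂ), ((liouvilleNumber 2 : ℝ) : ℂ), (ρ : ℂ)] →
      (∀ ω : ℕ, ∃ h : Fin n → ℤ, h ≠ 0 ∧ ‖∑ i, (h i : ℂ) * z i‖ < 1 / (1 + ∑ i, (|h i| : ℝ)) ^ ω) →
      (¬ ∀ m : ℕ, ∃ h : Fin n → ℤ, h ≠ 0 ∧
        ‖∑ i, (h i : ℂ) * z i‖ < Real.exp (-((1 + ∑ i, (|h i| : ℝ)) ^ m))) →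
      (n : Cardinal) ≤ Algebra.trdeg ℚ
        ↥(IntermediateField.adjoin ℚ (Set.range z ∪ Set.range (Complex.exp ∘ z))) := by
  intro n z hz hrange _ _
  exact sb_of_range_eq' hz.injective hrange (sb_collarWall3 hρ)

/-- **ITEM 33364 ON THE COLLAR WALL, π-twin `(π, πℓ₂, πρ)` — HYPOTHESIS-FREE for the WHOLE class.** -/
theorem finiteOrderLiouvilleSchanuel_collarWall3_pi {ρ : ℝ} (hρ : DyadicCollarLiouville ρ) :
    ∀ (n : ℕ) (z : Fin n → ℂ), LinearIndependent ℚ z →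
      Set.range z = Set.range ![(Real.pi : ℂ), (Real.pi : ℂ) * ((liouvilleNumber 2 : ℝ) : ℂ),
        (Real.pi : ℂ) * (ρ : ℂ)] →
      (∀ ω : ℕ, ∃ h : Fin n → ℤ, h ≠ 0 ∧ ‖∑ i, (h i : ℂ) * z i‖ < 1 / (1 + ∑ i, (|h i| : ℝ)) ^ ω) →
      (¬ ∀ m : ℕ, ∃ h : Fin n → ℤ, h ≠ 0 ∧
        ‖∑ i, (h i : ℂ) * z i‖ < Real.exp (-((1 + ∑ i, (|h i| : ℝ)) ^ m))) →
      (n : Cardinal) ≤ Algebra.trdeg ℚ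
        ↥(IntermediateField.adjoin ℚ (Set.range z ∪ Set.range (Complex.exp ∘ z))) := by
  intro n z hz hrange _ _
  exact sb_of_range_eq' hz.injective hrange (sb_collarWall3_pi hρ)

/-- **ITEM 31077 ON THE COLLAR WALL `(1, ℓ₂, ρ)` — HYPOTHESIS-FREE** (binders of
`Summit.Schanuel.Schanuel.Theses.RootDecomp1K.CoordLiouvilleSchanuel` verbatim + the cell line; bookkeeping inside the
cell — g48's `coordLiouvilleSchanuel_collarPair` is the PAIR `(ℓ₂, ρ)`). -/
theorem coordLiouvilleSchanuel_collarWall3 {ρ : ℝ} (hρ : DyadicCollarLiouville ρ) :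
    ∀ (n : ℕ) (z : Fin n → ℂ), LinearIndependent ℚ z →
      Set.range z = Set.range ![(1 : ℂ), ((liouvilleNumber 2 : ℝ) : ℂ), (ρ : ℂ)] →
      (∃ w ∈ Submodule.span ℚ (Set.range z), Liouville w.re ∨ Liouville w.im) →
      (n : Cardinal) ≤ Algebra.trdeg ℚ
        ↥(IntermediateField.adjoin ℚ (Set.range z ∪ Set.range (Complex.exp ∘ z))) := by
  intro n z hz hrange _
  exact sb_of_range_eq' hz.injective hrange (sb_collarWall3 hρ)

end Walls

end Summit.Schanuel.Schanuel.Theorems.RootDecomp1KCollarWall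

end
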